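import Literature.Analysis.FluidPDE.JiaSverak2014RepresentationData
import Literature.Analysis.FluidPDE.JiaSverak2014DatumContinuation
import Literature.Analysis.FluidPDE.CaloricRemainderCalculus
import HarnessLib

/-!
# The weak forced heat equation with datum satisfied by a cut-off local Leray solution

Analysis/FluidPDE support file (everything proved; two auxiliary definitions with bodies, no
named facts) for the discharge of the named fact
`Literature.Analysis.FluidPDE.jia_sverak_2014_local_higher_regularity`
(`JiaSverak2014LocalRegularity.lean`; H. Jia, V. Šverák, Invent. Math. 196 (2014) =
arXiv:1204.0529, §4, proof of Thm. 4.1, with the bootstrapping of the proof of Thm. 3.2, arXiv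
p. 9: "`u = u₁ + u₂ + u₃`, `u₁ = ∫₀ᵗ e^{Δ(t-s)}[-div(u ⊗ u η) - ∇(pη)] ds`, `u₂ = e^{Δt}(u₀η)`,
`u₃` caloric").

Multiplying the Navier–Stokes equations by a smooth compactly supported cut-off `ζ = ζ(x)` gives,
for `W = ζu`, a forced heat equation
`∂ₜW - ΔW = G₀ - Σⱼ ∂ⱼ G₁ʲ`, `W(0) = ζu₀`, with
`G₀ = (Δζ) u + ⟨u, ∇ζ⟩ u + p ∇ζ` and `G₁ʲ = 2 (∂ⱼζ) u + ζ uⱼ u + ζ p eⱼ`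
(`div(ζ u ⊗ u) = ζ (u·∇)u + ⟨u,∇ζ⟩u`, `∇(ζp) = ζ∇p + p∇ζ`, `Δ(ζu) = ζΔu + 2∇ζ·∇u + (Δζ)u`,
everything in divergence form so that no derivative falls on `u` or `p`). This file proves the
**weak form with initial datum** of that equation for a local Leray solution `(u, p)` on a slab
`(0,T') × ℝ³` (Lemarié-Rieusset 2016, Def. 14.1), in exactly the shape consumed by the caloric
duality lemma `Literature.Analysis.FluidPDE.ae_eq_heatMild_of_weakHeat`
(`LocalisedHeatMildDuality.lean`): for every test field `Ψ` on `(-∞, T) × ℝ³`, `0 < T ≤ T'`,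

  `∫∫_{(0,T)×ℝ³} (⟪ζu, ∂ₜΨ⟫ + ⟪ζu, ΔΨ⟫ + ⟪G₀, Ψ⟫ + Σⱼ ⟪G₁ʲ, ∂ⱼΨ⟫) + ∫ ⟪ζu₀, Ψ(0)⟫ = 0`

(`IsLocalLeraySolutionOn.weakHeat_identity_cutoff`). Proof: the weak form of the Navier–Stokes
equations with initial datum (`IsLocalLeraySolutionOn.weakIdentity_datum_gauge`, Robinson–Rodrigo–
Sadowski 2016, §3.1 (3.1)) tested with `ψ = ζΨ`, and the Leibniz rules for `∂ₜ(ζΨ)`,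
`(u·∇)(ζΨ)`, `Δ(ζΨ)`, `div(ζΨ)` (`CaloricRemainderCalculus.lean`, `WholeSpaceIBP.lean`).

* `heatCutoffForce ζ u p`, `heatCutoffFlux ζ u p j` — the data `G₀`, `G₁ʲ` (definitions);
* `isSpaceTimeTestOn_smul_of_contDiff` — `ζΨ` is a test field when `Ψ` is;
* `inner_weakForm_cutoff_eq` — the pointwise expansion of the Navier–Stokes weak-form integrand
  at `ψ = ζΨ` into the heat weak-form integrand with data `G₀`, `G₁`;
* `IsLocalLeraySolutionOn.weakHeat_identity_cutoff` — the weak forced heat equation with datum.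

## Mathlib / tree search

Tree (all used): `IsLocalLeraySolutionOn.weakIdentity_datum_gauge`
(`JiaSverak2014RepresentationData`), `JiaSverak2014.integrableOn_weakForm_slab`
(`JiaSverak2014DatumContinuation`), `setIntegral_slab_eq_integral_integral`
(`LocalEnergyConcatenation`), `convect_smul_field`, `laplacian_smul_field`
(`CaloricRemainderCalculus`), `divergence_smul_apply` (`WholeSpaceIBP`),
`divergence_eq_sum_inner_fderiv` (`VectorCalculus`). Mathlib: `EuclideanSpace.basisFun`,
`OrthonormalBasis.sum_repr'`, `deriv_const_smul`.

## References

* H. Jia, V. Šverák, Invent. Math. 196 (2014) = arXiv:1204.0529, §3 proof of Thm. 3.2 (p. 9),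
  §4 proof of Thm. 4.1. Bib key `JiaSverak2014`.
* J. C. Robinson, J. L. Rodrigo, W. Sadowski, *The Three-Dimensional Navier–Stokes Equations*
  (2016), §3.1 (3.1). Bib key `RobinsonRodrigoSadowski2016`.
* P. G. Lemarié-Rieusset, *The Navier–Stokes Problem in the 21st Century* (2016), Def. 14.1.
  Bib key `LemarieRieusset2016`.
-/

noncomputable section

open MeasureTheory TopologicalSpace Set Function Filter Metric InnerProductSpace
open _root_.Topology
open scoped ENNReal NNReal RealInnerProductSpace Laplacian ContDiff

namespace Literature.Analysis.FluidPDE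

/-- Local notation for physical space `ℝ³ = EuclideanSpace ℝ (Fin 3)`. -/
local notation "ℝ³" => EuclideanSpace ℝ (Fin 3)

/-- Local notation for the standard basis vectors of `ℝ³`. -/
local notation "𝐞" j => EuclideanSpace.single (j : Fin 3) (1 : ℝ)

/-! ### The data of the cut-off heat equation -/

/-- **The force of the cut-off equation**: `G₀ = (Δζ) u + ⟨u, ∇ζ⟩ u + p ∇ζ`, the zeroth-order
data produced by multiplying the Navier–Stokes equations by a cut-off `ζ(x)` (Jia–Šverák 2014,
proof of Thm. 3.2: the commutator terms of `u₁`). [cite: JiaSverak2014, §3 proof of Thm. 3.2 (arXiv p. 9)] -/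
def heatCutoffForce (ζ : ℝ³ → ℝ) (u : ℝ → ℝ³ → ℝ³) (p : ℝ → ℝ³ → ℝ) (t : ℝ) (x : ℝ³) : ℝ³ :=
  (Δ ζ) x • u t x + ⟪u t x, gradient ζ x⟫ • u t x + p t x • gradient ζ x

/-- **The fluxes of the cut-off equation**: `G₁ʲ = 2 (∂ⱼζ) u + ζ uⱼ u + ζ p eⱼ`, the data under
one divergence (`-Σⱼ ∂ⱼG₁ʲ = -2∇ζ·∇u - ... = -div(ζ u ⊗ u) - ∇(ζ p) - 2 div(u ⊗ ∇ζ)` up to the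
zeroth-order terms collected in `heatCutoffForce`; Jia–Šverák 2014, proof of Thm. 3.2:
`-div(u ⊗ u η) - ∇(pη)`). [cite: JiaSverak2014, §3 proof of Thm. 3.2 (arXiv p. 9)] -/
def heatCutoffFlux (ζ : ℝ³ → ℝ) (u : ℝ → ℝ³ → ℝ³) (p : ℝ → ℝ³ → ℝ) (j : Fin 3) (t : ℝ) (x : ℝ³) :
    ℝ³ :=
  (2 * fderiv ℝ ζ x (𝐞 j)) • u t x + (ζ x * u t x j) • u t x + (ζ x * p t x) • (𝐞 j)

/-- Unfolding `heatCutoffForce`. [folklore] -/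
theorem heatCutoffForce_apply (ζ : ℝ³ → ℝ) (u : ℝ → ℝ³ → ℝ³) (p : ℝ → ℝ³ → ℝ) (t : ℝ) (x : ℝ³) :
    heatCutoffForce ζ u p t x =
      (Δ ζ) x • u t x + ⟪u t x, gradient ζ x⟫ • u t x + p t x • gradient ζ x := rfl

/-- Unfolding `heatCutoffFlux`. [folklore] -/
theorem heatCutoffFlux_apply (ζ : ℝ³ → ℝ) (u : ℝ → ℝ³ → ℝ³) (p : ℝ → ℝ³ → ℝ) (j : Fin 3) (t : ℝ)
    (x : ℝ³) :
    heatCutoffFlux ζ u p j t x =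
      (2 * fderiv ℝ ζ x (𝐞 j)) • u t x + (ζ x * u t x j) • u t x + (ζ x * p t x) • (𝐞 j) := rfl

/-- The data vanish where the cut-off vanishes to second order (off `tsupport ζ`). [folklore] -/
theorem heatCutoffForce_eq_zero_of_notMem {ζ : ℝ³ → ℝ} {x : ℝ³} (hx : x ∉ tsupport ζ)
    (u : ℝ → ℝ³ → ℝ³) (p : ℝ → ℝ³ → ℝ) (t : ℝ) : heatCutoffForce ζ u p t x = 0 := by
  have hg : gradient ζ x = 0 := by
    rw [gradient, fderiv_of_notMem_tsupport ℝ hx, map_zero]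
  have hL : (Δ ζ) x = 0 := laplacian_eq_zero_of_notMem_tsupport hx
  simp [heatCutoffForce, hg, hL]

/-- The fluxes vanish off `tsupport ζ`. [folklore] -/
theorem heatCutoffFlux_eq_zero_of_notMem {ζ : ℝ³ → ℝ} {x : ℝ³} (hx : x ∉ tsupport ζ)
    (u : ℝ → ℝ³ → ℝ³) (p : ℝ → ℝ³ → ℝ) (j : Fin 3) (t : ℝ) : heatCutoffFlux ζ u p j t x = 0 := by
  have hD : fderiv ℝ ζ x = 0 := fderiv_of_notMem_tsupport ℝ hx
  have hz : ζ x = 0 := image_eq_zero_of_notMem_tsupport hx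
  simp [heatCutoffFlux, hD, hz]

/-! ### The test field `ζΨ` -/

/-- **`ζΨ` is a test field on `Q`** when `Ψ` is and `ζ = ζ(x)` is smooth (the support only
shrinks). [folklore] -/
theorem isSpaceTimeTestOn_smul_of_contDiff {F : Type*} [NormedAddCommGroup F] [NormedSpace ℝ F]
    {Q : Opens (ℝ × ℝ³)} {ζ : ℝ³ → ℝ} (hζ : ContDiff ℝ ∞ ζ) {Ψ : ℝ → ℝ³ → F}
    (hΨ : IsSpaceTimeTestOn Q Ψ) : IsSpaceTimeTestOn Q fun t x => ζ x • Ψ t x := by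
  have heq : uncurry (fun t x => ζ x • Ψ t x) = fun z => (ζ ∘ Prod.snd) z • uncurry Ψ z := rfl
  refine ⟨?_, ?_, ?_⟩
  · rw [heq]; exact (hζ.comp contDiff_snd).smul hΨ.contDiff
  · rw [heq]; exact hΨ.hasCompactSupport.smul_left
  · rw [heq]
    exact (tsupport_smul_subset_right (ζ ∘ Prod.snd) (uncurry Ψ)).trans hΨ.tsupport_subset

/-! ### The pointwise expansion -/

/-- A vector of `ℝ³` along the standard basis: `v = Σⱼ vⱼ eⱼ`. [folklore] -/
theorem eq_sum_coord_smul_single (v : ℝ³) : v = ∑ j : Fin 3, v j • (𝐞 j) := by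
  conv_lhs => rw [← (EuclideanSpace.basisFun (Fin 3) ℝ).sum_repr' v]
  refine Finset.sum_congr rfl fun j _ => ?_
  rw [EuclideanSpace.basisFun_apply, EuclideanSpace.inner_single_left]
  simp

/-- The coordinates of the gradient are the partial derivatives: `(∇ζ)ⱼ = ∂ⱼζ`. [folklore] -/
theorem gradient_apply_coord (ζ : ℝ³ → ℝ) (x : ℝ³) (j : Fin 3) :
    gradient ζ x j = fderiv ℝ ζ x (𝐞 j) := by
  have h : ⟪(𝐞 j), gradient ζ x⟫ = gradient ζ x j := by
    rw [EuclideanSpace.inner_single_left]; simp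
  rw [← h, real_inner_comm, gradient, InnerProductSpace.toDual_symm_apply]

/-- **The pointwise expansion of the Navier–Stokes weak-form integrand at `ψ = ζΨ`.** For a
smooth `ζ = ζ(x)` and a smooth space–time field `Ψ`, at every `(t, x)`,
`⟪u, ∂ₜ(ζΨ)⟫ + ⟪u, (u·∇)(ζΨ)⟫ + ⟪u, Δ(ζΨ)⟫ + p div(ζΨ)
 = ⟪ζu, ∂ₜΨ⟫ + ⟪ζu, ΔΨ⟫ + ⟪G₀, Ψ⟫ + Σⱼ ⟪G₁ʲ, ∂ⱼΨ⟫`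
with `G₀ = heatCutoffForce ζ u p`, `G₁ʲ = heatCutoffFlux ζ u p j`. [cite: JiaSverak2014, §3 proof of Thm. 3.2 (arXiv p. 9), the decomposition u = u₁ + u₂ + u₃] -/
theorem inner_weakForm_cutoff_eq {ζ : ℝ³ → ℝ} (hζ : ContDiff ℝ ∞ ζ) {Ψ : ℝ → ℝ³ → ℝ³}
    (hΨ : ContDiff ℝ ∞ (uncurry Ψ)) (u : ℝ → ℝ³ → ℝ³) (p : ℝ → ℝ³ → ℝ) (t : ℝ) (x : ℝ³) :
    ⟪u t x, timeDeriv (fun s y => ζ y • Ψ s y) t x⟫ +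
        ⟪u t x, convect (u t) (fun y => ζ y • Ψ t y) x⟫ +
        1 * ⟪u t x, Δ (fun y => ζ y • Ψ t y) x⟫ +
        p t x * VectorCalculus.divergence (fun y => ζ y • Ψ t y) x =
      ⟪ζ x • u t x, timeDeriv Ψ t x⟫ + ⟪ζ x • u t x, Δ (Ψ t) x⟫ +
        ⟪heatCutoffForce ζ u p t x, Ψ t x⟫ +
        ∑ j : Fin 3, ⟪heatCutoffFlux ζ u p j t x, fderiv ℝ (Ψ t) x (𝐞 j)⟫ := by
  -- regularity of the slices
  have hΨt : ContDiff ℝ ∞ (Ψ t) := hΨ.comp (contDiff_prodMk_right t)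
  have hΨ2 : ContDiff ℝ 2 (Ψ t) := contDiff_infty.1 hΨt 2
  have hζ2 : ContDiff ℝ 2 ζ := contDiff_infty.1 hζ 2
  have hζd : DifferentiableAt ℝ ζ x := (hζ.differentiable (by simp)) x
  have hΨd : DifferentiableAt ℝ (Ψ t) x := (hΨt.differentiable (by simp)) x
  have hline : DifferentiableAt ℝ (fun s => Ψ s x) t :=
    ((hΨ.comp (contDiff_prodMk_left x)).differentiable (by simp)) t
  -- abbreviations
  set v : ℝ³ := u t x with hv
  set q : ℝ := p t x with hq
  set D : ℝ³ →L[ℝ] ℝ³ := fderiv ℝ (Ψ t) x with hD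
  set g : ℝ³ := gradient ζ x with hg
  -- (i) the time derivative
  have T1 : ⟪v, timeDeriv (fun s y => ζ y • Ψ s y) t x⟫ = ζ x * ⟪v, timeDeriv Ψ t x⟫ := by
    simp only [timeDeriv_apply]
    rw [deriv_fun_const_smul (ζ x) hline, real_inner_smul_right]
  -- (ii) the convective term
  have hDv : D v = ∑ j : Fin 3, v j • D (𝐞 j) := by
    conv_lhs => rw [eq_sum_coord_smul_single v]
    simp [map_sum, map_smul]
  have T2 : ⟪v, convect (u t) (fun y => ζ y • Ψ t y) x⟫ =
      ⟪v, g⟫ * ⟪v, Ψ t x⟫ + ∑ j : Fin 3, (ζ x * v j) * ⟪v, D (𝐞 j)⟫ := by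
    rw [convect_smul_field hζd hΨd, inner_add_right, real_inner_smul_right, real_inner_smul_right,
      convect_apply, ← hD, ← hv, hDv, inner_sum, Finset.mul_sum]
    refine congrArg _ (Finset.sum_congr rfl fun j _ => ?_)
    rw [real_inner_smul_right]; ring
  -- (iii) the Laplacian
  have hDg : D g = ∑ j : Fin 3, fderiv ℝ ζ x (𝐞 j) • D (𝐞 j) := by
    conv_lhs => rw [eq_sum_coord_smul_single g]
    simp [map_sum, map_smul, hg, gradient_apply_coord]
  have T3 : 1 * ⟪v, Δ (fun y => ζ y • Ψ t y) x⟫ =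
      ζ x * ⟪v, Δ (Ψ t) x⟫ + (Δ ζ) x * ⟪v, Ψ t x⟫ +
        ∑ j : Fin 3, (2 * fderiv ℝ ζ x (𝐞 j)) * ⟪v, D (𝐞 j)⟫ := by
    rw [one_mul, laplacian_smul_field hζ2 hΨ2 x, ← hD, ← hg, inner_add_right, inner_add_right,
      real_inner_smul_right, real_inner_smul_right, real_inner_smul_right, hDg, inner_sum,
      Finset.mul_sum]
    have e : ∑ j : Fin 3, (2 : ℝ) * ⟪v, fderiv ℝ ζ x (𝐞 j) • D (𝐞 j)⟫ =
        ∑ j : Fin 3, 2 * fderiv ℝ ζ x (𝐞 j) * ⟪v, D (𝐞 j)⟫ :=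
      Finset.sum_congr rfl fun j _ => by rw [real_inner_smul_right]; ring
    rw [e]; ring
  -- (iv) the pressure term
  have hdiv : VectorCalculus.divergence (Ψ t) x = ∑ j : Fin 3, ⟪(𝐞 j), D (𝐞 j)⟫ := by
    rw [divergence_eq_sum_inner_fderiv (EuclideanSpace.basisFun (Fin 3) ℝ)]
    simp [EuclideanSpace.basisFun_apply, hD]
  have T4 : q * VectorCalculus.divergence (fun y => ζ y • Ψ t y) x =
      q * ⟪g, Ψ t x⟫ + ∑ j : Fin 3, (ζ x * q) * ⟪(𝐞 j), D (𝐞 j)⟫ := by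
    rw [divergence_smul_apply hζd hΨd, ← hg, hdiv, real_inner_comm (Ψ t x) g, mul_add,
      Finset.mul_sum, Finset.mul_sum, add_comm]
    refine congrArg _ (Finset.sum_congr rfl fun j _ => ?_)
    ring
  -- the right-hand side
  have R1 : ⟪ζ x • v, timeDeriv Ψ t x⟫ = ζ x * ⟪v, timeDeriv Ψ t x⟫ := real_inner_smul_left _ _ _
  have R2 : ⟪ζ x • v, Δ (Ψ t) x⟫ = ζ x * ⟪v, Δ (Ψ t) x⟫ := real_inner_smul_left _ _ _
  have R3 : ⟪heatCutoffForce ζ u p t x, Ψ t x⟫ =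
      (Δ ζ) x * ⟪v, Ψ t x⟫ + ⟪v, g⟫ * ⟪v, Ψ t x⟫ + q * ⟪g, Ψ t x⟫ := by
    rw [heatCutoffForce_apply, ← hv, ← hq, ← hg, inner_add_left, inner_add_left,
      real_inner_smul_left, real_inner_smul_left, real_inner_smul_left]
  have R4 : ∑ j : Fin 3, ⟪heatCutoffFlux ζ u p j t x, D (𝐞 j)⟫ =
      ∑ j : Fin 3, ((2 * fderiv ℝ ζ x (𝐞 j)) * ⟪v, D (𝐞 j)⟫ + (ζ x * v j) * ⟪v, D (𝐞 j)⟫ +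
        (ζ x * q) * ⟪(𝐞 j), D (𝐞 j)⟫) := by
    refine Finset.sum_congr rfl fun j _ => ?_
    rw [heatCutoffFlux_apply, ← hv, ← hq, inner_add_left, inner_add_left, real_inner_smul_left,
      real_inner_smul_left, real_inner_smul_left]
  rw [T1, T2, T3, T4, R1, R2, R3, R4, Finset.sum_add_distrib, Finset.sum_add_distrib]
  ring

/-! ### The weak forced heat equation with datum -/

/-- **The weak forced heat equation with initial datum of a cut-off local Leray solution.** Let
`(u, p)` be a local Leray solution on `(0,T') × ℝ³` with measurable datum `u₀`, `0 < T ≤ T'`,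
and `ζ = ζ(x)` a smooth compactly supported cut-off. Then for every test field `Ψ` on
`(-∞, T) × ℝ³`,
`∫∫_{(0,T)×ℝ³} (⟪ζu, ∂ₜΨ⟫ + ⟪ζu, ΔΨ⟫ + ⟪G₀, Ψ⟫ + Σⱼ ⟪G₁ʲ, ∂ⱼΨ⟫) + ∫ ⟪ζu₀, Ψ(0)⟫ = 0`
with `G₀ = (Δζ)u + ⟨u,∇ζ⟩u + p∇ζ`, `G₁ʲ = 2(∂ⱼζ)u + ζuⱼu + ζp eⱼ`: the field `W = ζu` is a
distributional solution of `∂ₜW - ΔW = G₀ - Σⱼ∂ⱼG₁ʲ` on `(0,T) × ℝ³` with initial datum `ζu₀`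
(the weak Navier–Stokes identity with datum, Robinson–Rodrigo–Sadowski (3.1), tested with `ζΨ`;
Jia–Šverák 2014, proof of Thm. 3.2, the equation behind `u = u₁ + u₂ + u₃`).
[cite: JiaSverak2014, §3 proof of Thm. 3.2 (arXiv p. 9)] [cite: RobinsonRodrigoSadowski2016, §3.1 p. 58 (3.1)] -/
theorem IsLocalLeraySolutionOn.weakHeat_identity_cutoff {T' T : ℝ} {u₀ : ℝ³ → ℝ³}
    {u : ℝ → ℝ³ → ℝ³} {p : ℝ → ℝ³ → ℝ} (hu : IsLocalLeraySolutionOn T' 1 u₀ u p)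
    (hm₀ : AEStronglyMeasurable u₀ volume) (hT : 0 < T) (hTT' : T ≤ T') {ζ : ℝ³ → ℝ}
    (hζ : ContDiff ℝ ∞ ζ) {Ψ : ℝ → ℝ³ → ℝ³}
    (hΨ : IsSpaceTimeTestOn (slab ℝ³ (Iio T) isOpen_Iio) Ψ) :
    (∫ z in Ioo 0 T ×ˢ (univ : Set ℝ³),
        (⟪ζ z.2 • u z.1 z.2, timeDeriv Ψ z.1 z.2⟫ + ⟪ζ z.2 • u z.1 z.2, Δ (Ψ z.1) z.2⟫ +
          ⟪heatCutoffForce ζ u p z.1 z.2, Ψ z.1 z.2⟫ +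
          ∑ j : Fin 3, ⟪heatCutoffFlux ζ u p j z.1 z.2, fderiv ℝ (Ψ z.1) z.2 (𝐞 j)⟫)) +
      ∫ x, ⟪ζ x • u₀ x, Ψ 0 x⟫ = 0 := by
  -- the test field `Φ = ζΨ`
  set Φ : ℝ → ℝ³ → ℝ³ := fun t x => ζ x • Ψ t x with hΦ
  have hΦT : IsSpaceTimeTestOn (slab ℝ³ (Iio T) isOpen_Iio) Φ := isSpaceTimeTestOn_smul_of_contDiff hζ hΨ
  have hΦtop : IsSpaceTimeTestOn (⊤ : Opens (ℝ × ℝ³)) Φ := hΦT.mono le_top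
  -- the weak Navier–Stokes identity with datum, tested with `Φ`
  have hc : MemLp (fun _ : ℝ => (0 : ℝ)) (3 / 2 : ℝ≥0∞) (volume.restrict (Ioo 0 T')) := by
    haveI : IsFiniteMeasure ((volume : Measure ℝ).restrict (Ioo 0 T')) :=
      ⟨by rw [Measure.restrict_apply_univ]; exact measure_Ioo_lt_top⟩
    exact memLp_const 0
  have key := hu.weakIdentity_datum_gauge hm₀ hT hTT' hc hΦT
  simp only [sub_zero] at key
  -- the integrand is the weak-form integrand of `Φ`, pointwise
  set F : ℝ × ℝ³ → ℝ := fun z => ⟪u z.1 z.2, timeDeriv Φ z.1 z.2⟫ +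
    ⟪u z.1 z.2, convect (u z.1) (Φ z.1) z.2⟫ + 1 * ⟪u z.1 z.2, Δ (Φ z.1) z.2⟫ +
    p z.1 z.2 * VectorCalculus.divergence (Φ z.1) z.2 with hF
  have hpt : ∀ z : ℝ × ℝ³, F z =
      ⟪ζ z.2 • u z.1 z.2, timeDeriv Ψ z.1 z.2⟫ + ⟪ζ z.2 • u z.1 z.2, Δ (Ψ z.1) z.2⟫ +
        ⟪heatCutoffForce ζ u p z.1 z.2, Ψ z.1 z.2⟫ +
        ∑ j : Fin 3, ⟪heatCutoffFlux ζ u p j z.1 z.2, fderiv ℝ (Ψ z.1) z.2 (𝐞 j)⟫ := fun z =>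
    inner_weakForm_cutoff_eq hζ hΨ.contDiff u p z.1 z.2
  have hint : IntegrableOn F (Ioo 0 T ×ˢ (univ : Set ℝ³)) volume :=
    JiaSverak2014.integrableOn_weakForm_slab (hu.mono hTT') hΦtop
  have e1 : (∫ z in Ioo 0 T ×ˢ (univ : Set ℝ³),
        (⟪ζ z.2 • u z.1 z.2, timeDeriv Ψ z.1 z.2⟫ + ⟪ζ z.2 • u z.1 z.2, Δ (Ψ z.1) z.2⟫ +
          ⟪heatCutoffForce ζ u p z.1 z.2, Ψ z.1 z.2⟫ +
          ∑ j : Fin 3, ⟪heatCutoffFlux ζ u p j z.1 z.2, fderiv ℝ (Ψ z.1) z.2 (𝐞 j)⟫)) =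
      ∫ z in Ioo 0 T ×ˢ (univ : Set ℝ³), F z :=
    setIntegral_congr_fun (measurableSet_Ioo.prod MeasurableSet.univ) fun z _ => (hpt z).symm
  have e2 := LocalEnergyConcat.setIntegral_slab_eq_integral_integral hint
  -- the datum term
  have e3 : ∫ x, ⟪ζ x • u₀ x, Ψ 0 x⟫ = ∫ x, ⟪u₀ x, Φ 0 x⟫ :=
    integral_congr_ae (Eventually.of_forall fun x => by
      simp only [hΦ, real_inner_smul_left, real_inner_smul_right])
  rw [e1, e2, e3]
  exact key

end Literature.Analysis.FluidPDE

end
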